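import Mathlib
import Literature.NumberTheory.Transcendental.KZRulesAssociator
import Literature.NumberTheory.Transcendental.KZLogCalculusProofs
import Summits.KontsevichZagierPeriods.KontsevichZagierPeriods.Theorems.InverseLandauTateLiftingFubiniReduction
import Summits.KontsevichZagierPeriods.KontsevichZagierPeriods.Theorems.InverseLandauTateLiftingDimZeroSector
import Summits.KontsevichZagierPeriods.KontsevichZagierPeriods.Theorems.InverseLandauTateLiftingDimZeroLiftAlg

/-!
# `TateLifting` (stmt-KontsevichZagierPeriods-9129), line `Sketch` — stub `stub_dimZeroRing`

THE RING OF DIMENSION-ZERO CLASSES in the formal period ring `P = FormalRep ⧸ relations` of the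
Kontsevich–Zagier calculus (`KZ.FormalPeriodRing`, `KZ.toFormalPeriod : FormalRep →ₙ+* P`,
`KZ.evalP : P →+* ℝ`). Let `K₀ ⊆ P` be the subring generated by the classes `⟦[b]⟧` of the
integral representations `b` over the point `ℝ⁰ = (Fin 0 → ℝ) = {pt}`. Then

* every element of `K₀` IS such a class `⟦[b]⟧` with FULL domain `b.domain = ℝ⁰`
  (`DimZeroRing.exists_rep_of_mem_closure`): a generator with empty domain is a relation
  (`Fubini.dimZero_cases`), i.e. `0 = ⟦[pt, 0]⟧`; `1 = ⟦[pt, 1]⟧` (`KZ.toFormalPeriod_of_unit`);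
  sums and negatives by integrand additivity over the common domain `ℝ⁰`
  (`KZ.integrandAddRel`, `KZ.of_add_of_mem_relations_of_eqOn_neg`) with the constant
  representation `[pt, a₁ + a₂]` (`KZ.IntegralRep.constMul _ _ IntegralRep.unit`, the constants
  `aᵢ = bᵢ.integrand pt` being real-algebraic, `DimOne.dzl_isAlgebraic_integrand`) and `b.neg`;
  products by the Fubini product `⟦[b₁]⟧ ⟦[b₂]⟧ = ⟦[b₁.prod b₂]⟧` (`KZ.toFormalPeriod_of_mul_of`,
  dimension `0 + 0 = 0`, domain `pt × pt = ℝ⁰`);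
* the value `evalP ⟦[b]⟧ = value b = b.integrand pt` (`KZ.evalP_toFormalPeriod_of`,
  `DimOne.dzs_value_eq_integrand`: Lebesgue measure on `ℝ⁰` is the Dirac mass) is ALGEBRAIC over
  `ℚ` (`DimOne.dzl_isAlgebraic_integrand`: the value of a `ℚ`-semialgebraic function at the
  vacuously algebraic point);
* `evalP` is INJECTIVE on `K₀`: `b.integrand pt = 0` means the integrand vanishes on the domain,
  so `[b]` is a relation (`KZ.of_mem_relations_of_eqOn_zero`) and `⟦[b]⟧ = 0`
  (`KZ.toFormalPeriod_eq_zero_iff`).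

References: M. Kontsevich, D. Zagier, *Periods* (2001), §1.1 ("rational" may be replaced by
"algebraic"), §1.2 rule (1), §4.1 ("the product of integrals is again an integral (Fubini)").
-/

noncomputable section

open MeasureTheory Set
open Literature.ModelTheory.ExponentialFields (isSemialgebraic_univ)
open Literature.NumberTheory.Transcendental

namespace Summit.KontsevichZagierPeriods.InverseLandau

namespace DimZeroRing

/-! ### Dimension-zero classes with full domain (`dzr_`) -/

/-- **`0 = ⟦[pt, 0]⟧`**: the zero of `P` is the class of a representation over `ℝ⁰` with full
domain (the zero representation, itself a relation). [cite: KontsevichZagier2001, §1.2] -/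
theorem dzr_zero :
    ∃ b : KZ.IntegralRep 0, b.domain = Set.univ ∧
      (0 : KZ.FormalPeriodRing) = KZ.toFormalPeriod (KZ.of b) := by
  obtain ⟨z, hzd, hzi⟩ := KZ.exists_zeroRep (n := 0) (σ := univ) isSemialgebraic_univ
  refine ⟨z, hzd, ?_⟩
  rw [eq_comm, KZ.toFormalPeriod_eq_zero_iff]
  exact KZ.of_mem_relations_of_eqOn_zero z (by rw [hzi]; exact fun _ _ => rfl)

/-- **Generators**: the class of ANY representation over `ℝ⁰` is the class of one with full
domain (an empty domain gives a relation, `Fubini.dimZero_cases`, whose class is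
`0 = ⟦[pt, 0]⟧`). [cite: KontsevichZagier2001, §1.2] -/
theorem dzr_mem (b₀ : KZ.IntegralRep 0) :
    ∃ b : KZ.IntegralRep 0, b.domain = Set.univ ∧
      KZ.toFormalPeriod (KZ.of b₀) = KZ.toFormalPeriod (KZ.of b) := by
  rcases Fubini.dimZero_cases b₀ with h | h
  · rw [KZ.toFormalPeriod_eq_zero_of_mem h]
    exact dzr_zero
  · exact ⟨b₀, h, rfl⟩

/-- **`1 = ⟦[pt, 1]⟧`.** [cite: KontsevichZagier2001, §4.1] -/
theorem dzr_one :
    ∃ b : KZ.IntegralRep 0, b.domain = Set.univ ∧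
      (1 : KZ.FormalPeriodRing) = KZ.toFormalPeriod (KZ.of b) :=
  ⟨KZ.IntegralRep.unit, KZ.IntegralRep.unit_domain, KZ.toFormalPeriod_of_unit.symm⟩

/-- **Sums**: `⟦[pt, a₁]⟧ + ⟦[pt, a₂]⟧ = ⟦[pt, a₁ + a₂]⟧` by integrand additivity over `ℝ⁰`;
the constant `a₁ + a₂` is real-algebraic, so `[pt, a₁ + a₂] = (a₁ + a₂) · [pt, 1]` is an honest
representation (`KZ.IntegralRep.constMul`). [cite: KontsevichZagier2001, §1.2] -/
theorem dzr_add (b₁ b₂ : KZ.IntegralRep 0) (h₁ : b₁.domain = Set.univ)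
    (h₂ : b₂.domain = Set.univ) :
    ∃ b : KZ.IntegralRep 0, b.domain = Set.univ ∧
      KZ.toFormalPeriod (KZ.of b₁) + KZ.toFormalPeriod (KZ.of b₂) =
        KZ.toFormalPeriod (KZ.of b) := by
  have ha : IsAlgebraic ℚ (b₁.integrand default + b₂.integrand default) :=
    (DimOne.dzl_isAlgebraic_integrand b₁ (by rw [h₁]; exact mem_univ _)).add
      (DimOne.dzl_isAlgebraic_integrand b₂ (by rw [h₂]; exact mem_univ _))
  refine ⟨KZ.IntegralRep.unit.constMul _ ha, rfl, ?_⟩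
  rw [← map_add, eq_comm, KZ.toFormalPeriod_eq_iff, ← sub_sub]
  refine KZ.integrandAddRel_subset_relations ⟨0, _, b₁, b₂, ?_, ?_, fun x _ => ?_, rfl⟩
  · rw [h₁]; rfl
  · rw [h₂]; rfl
  · show (b₁.integrand default + b₂.integrand default) * 1 = b₁.integrand x + b₂.integrand x
    rw [mul_one, Subsingleton.elim x default]

/-- **Negatives**: `−⟦[pt, a]⟧ = ⟦[pt, −a]⟧` (`b.neg`,
`KZ.of_add_of_mem_relations_of_eqOn_neg`). [cite: KontsevichZagier2001, §1.2] -/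
theorem dzr_neg (b₁ : KZ.IntegralRep 0) (h₁ : b₁.domain = Set.univ) :
    ∃ b : KZ.IntegralRep 0, b.domain = Set.univ ∧
      -KZ.toFormalPeriod (KZ.of b₁) = KZ.toFormalPeriod (KZ.of b) := by
  refine ⟨b₁.neg, h₁, neg_eq_of_add_eq_zero_right ?_⟩
  rw [← map_add, KZ.toFormalPeriod_eq_zero_iff]
  exact KZ.of_add_of_mem_relations_of_eqOn_neg rfl fun _ _ => rfl

/-- **Products**: `⟦[b₁]⟧ ⟦[b₂]⟧ = ⟦[b₁.prod b₂]⟧` (Fubini product,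
`KZ.toFormalPeriod_of_mul_of`), a representation of dimension `0 + 0 = 0` with domain
`pt × pt = ℝ⁰`. [cite: KontsevichZagier2001, §4.1] -/
theorem dzr_mul (b₁ b₂ : KZ.IntegralRep 0) (h₁ : b₁.domain = Set.univ)
    (h₂ : b₂.domain = Set.univ) :
    ∃ b : KZ.IntegralRep 0, b.domain = Set.univ ∧
      KZ.toFormalPeriod (KZ.of b₁) * KZ.toFormalPeriod (KZ.of b₂) =
        KZ.toFormalPeriod (KZ.of b) := by
  refine ⟨b₁.prod b₂, ?_, KZ.toFormalPeriod_of_mul_of b₁ b₂⟩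
  show KZ.IntegralRep.prodDomain b₁ b₂ = univ
  exact Set.eq_univ_of_forall fun z => (KZ.IntegralRep.mem_prodDomain b₁ b₂ z).mpr
    ⟨by rw [h₁]; exact mem_univ _, by rw [h₂]; exact mem_univ _⟩

/-- **Every element of the subring `K₀` generated by the dimension-zero classes is a
dimension-zero class with full domain** (`Subring.closure_induction` on the five cases above).
[cite: KontsevichZagier2001, §1.2] -/
theorem exists_rep_of_mem_closure {x : KZ.FormalPeriodRing}
    (hx : x ∈ Subring.closure
      (Set.range fun b : KZ.IntegralRep 0 => KZ.toFormalPeriod (KZ.of b))) :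
    ∃ b : KZ.IntegralRep 0, b.domain = Set.univ ∧ x = KZ.toFormalPeriod (KZ.of b) := by
  induction hx using Subring.closure_induction with
  | mem x hx =>
    obtain ⟨b₀, rfl⟩ := hx
    exact dzr_mem b₀
  | zero => exact dzr_zero
  | one => exact dzr_one
  | add x y _ _ hx hy =>
    obtain ⟨b₁, h₁, rfl⟩ := hx
    obtain ⟨b₂, h₂, rfl⟩ := hy
    exact dzr_add b₁ b₂ h₁ h₂
  | neg x _ hx =>
    obtain ⟨b₁, h₁, rfl⟩ := hx
    exact dzr_neg b₁ h₁
  | mul x y _ _ hx hy =>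
    obtain ⟨b₁, h₁, rfl⟩ := hx
    obtain ⟨b₂, h₂, rfl⟩ := hy
    exact dzr_mul b₁ b₂ h₁ h₂

/-- **The value of a dimension-zero class with full domain** is the integrand at the point:
`evalP ⟦[b]⟧ = value b = b.integrand pt`. [cite: KontsevichZagier2001, §1.1] -/
theorem evalP_toFormalPeriod_of_eq_integrand (b : KZ.IntegralRep 0) (hb : b.domain = Set.univ) :
    KZ.evalP (KZ.toFormalPeriod (KZ.of b)) = b.integrand default := by
  rw [KZ.evalP_toFormalPeriod_of, DimOne.dzs_value_eq_integrand b hb]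

/-- **The value of a dimension-zero class with full domain is algebraic over `ℚ`.**
[cite: KontsevichZagier2001, §1.1] -/
theorem isAlgebraic_evalP (b : KZ.IntegralRep 0) (hb : b.domain = Set.univ) :
    IsAlgebraic ℚ (KZ.evalP (KZ.toFormalPeriod (KZ.of b))) := by
  rw [evalP_toFormalPeriod_of_eq_integrand b hb]
  exact DimOne.dzl_isAlgebraic_integrand b (by rw [hb]; exact mem_univ _)

/-- **`evalP` is injective on dimension-zero classes with full domain**: if `b.integrand pt = 0`
the integrand vanishes on the domain, so `[b]` is a relation and `⟦[b]⟧ = 0`.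
[cite: KontsevichZagier2001, §1.2] -/
theorem toFormalPeriod_eq_zero_of_evalP (b : KZ.IntegralRep 0) (hb : b.domain = Set.univ)
    (h : KZ.evalP (KZ.toFormalPeriod (KZ.of b)) = 0) : KZ.toFormalPeriod (KZ.of b) = 0 := by
  rw [evalP_toFormalPeriod_of_eq_integrand b hb] at h
  exact KZ.toFormalPeriod_eq_zero_iff.mpr
    (KZ.of_mem_relations_of_eqOn_zero b fun x _ => by rw [Subsingleton.elim x default]; exact h)

end DimZeroRing

/-- **The ring of dimension-zero classes** (stub `stub_dimZeroRing` of the lead's skeleton, the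
body of `DimZeroRing`): every element of the subring of the formal period ring generated by the
classes `⟦[b]⟧` of representations over the point `ℝ⁰` is such a class with full domain
(`DimZeroRing.exists_rep_of_mem_closure`: `0 = ⟦[pt, 0]⟧`, `1 = ⟦[pt, 1]⟧`, sums and negatives
by integrand additivity with real-algebraic constants, products by Fubini in dimension
`0 + 0 = 0`), its value `evalP ⟦[b]⟧ = b.integrand pt` is algebraic over `ℚ`
(`DimZeroRing.isAlgebraic_evalP`), and `evalP` is injective there
(`DimZeroRing.toFormalPeriod_eq_zero_of_evalP`). [cite: KontsevichZagier2001, §1.2] -/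
theorem tateLifting_dimZeroRing :
    ∀ x ∈ Subring.closure (Set.range fun b : KZ.IntegralRep 0 => KZ.toFormalPeriod (KZ.of b)),
      (∃ b : KZ.IntegralRep 0, b.domain = Set.univ ∧ x = KZ.toFormalPeriod (KZ.of b)) ∧
        IsAlgebraic ℚ (KZ.evalP x) ∧ (KZ.evalP x = 0 → x = 0) := by
  intro x hx
  obtain ⟨b, hb, rfl⟩ := DimZeroRing.exists_rep_of_mem_closure hx
  exact ⟨⟨b, hb, rfl⟩, DimZeroRing.isAlgebraic_evalP b hb,
    DimZeroRing.toFormalPeriod_eq_zero_of_evalP b hb⟩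

end Summit.KontsevichZagierPeriods.InverseLandau

end
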